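import Summits.ValiantsHypothesis.ValiantsHypothesis.Theorems.SymPencilSdcPerFourCellNineSeven
import Summits.ValiantsHypothesis.ValiantsHypothesis.Theorems.SymPencilPerFourOneRowPoint

/-!
# Route `SymPencil` — cell `(9, 7, 8)`: the detecting-pair hypothesis H978 IS the inner rank of
# the `2|2` row split of `per_4` on HYPERPLANES (`--supports` stmt-ValiantsHypothesis-5674
# `SdcSuperquadratic`; rung currency only — nothing here bears on `VP ≠ VNP`)

`SymPencilSdcPerFourCellNineSeven.false_of_rank_nine_le_twentySeven_of_H978` closes the cell
`(9, 7, 8)` of the size-`27` table modulo H978 («no `7`-dimensional `W ⊆ Sing Z(per₄)` with a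
detecting pair of rows carries a joint family of `8` squares»).  This file reduces H978 to the
clean statement in the format of `SymPencilPerFourInnerRankNine.false_of_joint_eight_squares`:

* **IR9H** («inner rank ≥ 9 on hyperplanes»): for every `7`-dimensional `V' ≤ K⁴ × K⁴` there are
  no `c : Fin 8 → K` and bilinear `t_r` with
  `Σ_r c_r t_r((a,b), y)² = per [a; b; y.1; y.2]` for all `a, b ∈ K⁴` and all `y ∈ V'`.

**Theorem** (`H978_of_IR9H`): IR9H ⇒ H978.  Proof: move the detecting rows to `2, 3`
(`SymPencilPerFourJointFamilyTransport.jointFamily_map_prodCongr`); rows `2, 3` map `W` injectively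
onto a `7`-dimensional `V'`; with `u` supported on rows `0, 1` the `s²`-coefficient of
`per_4 (u + s x)` (`x ∈ W` over `y ∈ V'`) is `per [a; b; y.1; y.2]` whatever the rows `0, 1` of `x`
are (`quartic_coeffs_eq_zero`), and the joint family composed with a linear section `V' → W`
(`LinearMap.exists_extend`) is a bilinear `8`-square representation on `V'`.  Hence
(`false_of_rank_nine_le_twentySeven_of_IR9H`) the cell `(9, 7, 8)` is empty GIVEN IR9H.
(Conversely every hyperplane of a two-row block is such a `W`, so IR9H is exactly what the cell
needs.)

Honest framing: IR9H is OPEN (the tree has the full-space bounds `≥ 9`, `≥ 10`: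
`SymPencilPerFourInnerRankNine`, `SymPencilPerFourInnerRankTen`); the cell `(9, 7, 8)` is closed
only conditionally; window `27 ≤ sdc(per₄) ≤ 29` UNCHANGED; stmt-5674 OPEN; `VP ≠ VNP` not moved;
no summit statement is proved here.  No definitions, no named facts. [folklore]
-/

noncomputable section

-- single-conjunct layout: Sub = Summit, duplicated namespace component intended
set_option linter.dupNamespace false

namespace Summit.ValiantsHypothesis.ValiantsHypothesis.Theorems.SymPencilSdcPerFourCellNineSevenSplit

open Matrix MvPolynomial Module
open Literature.Computability.AlgebraicComplexity
open Summit.ValiantsHypothesis.ValiantsHypothesis.Theorems.SymPencilPerFourInnerRankRows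
open Summit.ValiantsHypothesis.ValiantsHypothesis.Theorems.SymPencilPerFourRowForms
open Summit.ValiantsHypothesis.ValiantsHypothesis.Theorems.SymPencilPerFourOneRowKernel
open Summit.ValiantsHypothesis.ValiantsHypothesis.Theorems.SymPencilPerFourOneRowPoint
open Summit.ValiantsHypothesis.ValiantsHypothesis.Theorems.SymPencilPerFourJointFamilyTransport
open Summit.ValiantsHypothesis.ValiantsHypothesis.Theorems.SymPencilSdcPerFourCellNineSeven

universe u

variable {K : Type u} [Field K]

/-- A quartic `a₀ + a₁ s + a₂ s² + a₃ s³ + a₄ s⁴` vanishing at `s = 0, ±1, ±2` vanishes identically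
(characteristic `0`). [folklore] -/
theorem quartic_coeffs_eq_zero [CharZero K] (a₀ a₁ a₂ a₃ a₄ : K)
    (h : ∀ s : K, a₀ + a₁ * s + a₂ * s ^ 2 + a₃ * s ^ 3 + a₄ * s ^ 4 = 0) :
    a₀ = 0 ∧ a₁ = 0 ∧ a₂ = 0 ∧ a₃ = 0 ∧ a₄ = 0 := by
  have h0 := h 0
  have h1 := h 1
  have h2 := h (-1)
  have h3 := h 2
  have h4 := h (-2)
  have e0 : a₀ = 0 := by linear_combination h0
  have e24 : (2 : K) * (a₂ + a₄) = 0 := by linear_combination h1 + h2 - 2 * h0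
  have e24' : (8 : K) * (a₂ + 4 * a₄) = 0 := by linear_combination h3 + h4 - 2 * h0
  have ha4 : (24 : K) * a₄ = 0 := by linear_combination e24' - 4 * e24
  have ha4' : a₄ = 0 := (mul_eq_zero.1 ha4).resolve_left (by norm_num)
  have ha2 : a₂ = 0 := by
    have := (mul_eq_zero.1 e24).resolve_left two_ne_zero
    linear_combination this - ha4'
  have e13 : (2 : K) * (a₁ + a₃) = 0 := by linear_combination h1 - h2
  have e13' : (4 : K) * (a₁ + 4 * a₃) = 0 := by linear_combination h3 - h4
  have ha3 : (12 : K) * a₃ = 0 := by linear_combination e13' - 2 * e13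
  have ha3' : a₃ = 0 := (mul_eq_zero.1 ha3).resolve_left (by norm_num)
  have ha1 : a₁ = 0 := by
    have := (mul_eq_zero.1 e13).resolve_left two_ne_zero
    linear_combination this - ha3'
  exact ⟨e0, ha1, ha2, ha3', ha4'⟩

/-- **IR9H ⇒ H978**: the inner-rank bound on hyperplanes of the `2|2` split gives the
detecting-pair hypothesis of the cell `(9, 7, 8)`.  See the module docstring. [folklore] -/
theorem H978_of_IR9H [CharZero K]
    (IR9H : ∀ V' : Submodule K ((Fin 4 → K) × (Fin 4 → K)), finrank K V' = 7 →
      ∀ (c : Fin 8 → K)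
        (t : Fin 8 → (((Fin 4 → K) × (Fin 4 → K)) →ₗ[K] ((Fin 4 → K) × (Fin 4 → K)) →ₗ[K] K)),
      ¬ (∀ a b : Fin 4 → K, ∀ y ∈ V',
          ∑ r, c r * (t r (a, b) y) ^ 2 = (Matrix.of ![a, b, y.1, y.2]).permanent)) :
    ∀ W : Submodule K (Fin 4 × Fin 4 → K),
      (∀ x ∈ W, ∀ (r c : Fin 3 → Fin 4), Function.Injective r → Function.Injective c →
        ((Matrix.of fun i j => x (i, j)).submatrix r c).permanent = 0) →
      finrank K W = 7 → ∀ p q : Fin 4, p ≠ q →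
      (∀ x ∈ W, (∀ j, x (p, j) = 0) → (∀ j, x (q, j) = 0) → x = 0) →
      ∀ (c : Fin 8 → K) (β : Fin 8 → ((Fin 4 × Fin 4 → K) →ₗ[K] (Fin 4 × Fin 4 → K) →ₗ[K] K)),
      ¬ (∀ u : Fin 4 × Fin 4 → K, ∀ y ∈ W, ∃ e₀ e₁ : K, ∀ s : K,
          eval (u + s • y) (perPoly (Fin 4) K) = e₀ + s * e₁ + s ^ 2 * ∑ k, c k * (β k u y) ^ 2) := by
  classical
  intro W _ h7 p q hpq hdet c β hfam
  -- (1) move the detecting rows to `2, 3`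
  set σ₁ : Equiv.Perm (Fin 4) := Equiv.swap 2 p with hσ₁
  have hσ₁3 : σ₁ 3 ≠ p := by
    rw [hσ₁]
    by_cases hp3 : p = 3
    · rw [hp3, Equiv.swap_apply_right]; decide
    · rw [Equiv.swap_apply_of_ne_of_ne (by decide) (Ne.symm hp3)]; exact Ne.symm hp3
  set σ : Equiv.Perm (Fin 4) := σ₁.trans (Equiv.swap (σ₁ 3) q) with hσ
  have hσ2 : σ 2 = p := by
    rw [hσ, Equiv.trans_apply, hσ₁, Equiv.swap_apply_left, ← hσ₁,
      Equiv.swap_apply_of_ne_of_ne (Ne.symm hσ₁3) hpq]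
  have hσ3 : σ 3 = q := by rw [hσ, Equiv.trans_apply, Equiv.swap_apply_left]
  set Φ : (Fin 4 × Fin 4 → K) ≃ₗ[K] (Fin 4 × Fin 4 → K) :=
    LinearEquiv.funCongrLeft K K (Equiv.prodCongr σ (Equiv.refl (Fin 4))) with hΦ
  have hΦa : ∀ (x : Fin 4 × Fin 4 → K) (i j : Fin 4), Φ x (i, j) = x (σ i, j) := fun x i j => rfl
  set W' := W.map Φ.toLinearMap with hW'
  obtain ⟨c', β', hfam'⟩ := jointFamily_map_prodCongr W σ (Equiv.refl (Fin 4)) c β hfam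
  have hdet' : ∀ x ∈ W', (∀ j, x (2, j) = 0) → (∀ j, x (3, j) = 0) → x = 0 := by
    rintro _ ⟨x, hx, rfl⟩ h2 h3
    have hx0 : x = 0 := hdet x hx (fun j => by rw [← hσ2]; exact h2 j)
      (fun j => by rw [← hσ3]; exact h3 j)
    rw [hx0, map_zero]
  have h7' : finrank K W' = 7 := by rw [hW', LinearEquiv.finrank_map_eq, h7]
  -- (2) rows `2, 3` map `W'` injectively onto `V'`
  let π : (Fin 4 × Fin 4 → K) →ₗ[K] ((Fin 4 → K) × (Fin 4 → K)) :=
    { toFun := fun x => (fun j => x (2, j), fun j => x (3, j))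
      map_add' := fun x y => rfl
      map_smul' := fun a x => rfl }
  have hπ : ∀ x, π x = (fun j => x (2, j), fun j => x (3, j)) := fun x => rfl
  set f : W' →ₗ[K] ((Fin 4 → K) × (Fin 4 → K)) := π ∘ₗ W'.subtype with hf
  have hfinj : Function.Injective f := by
    intro x₁ x₂ h
    have hsub : f (x₁ - x₂) = 0 := by rw [map_sub, h, sub_self]
    have hzero : ((x₁ - x₂ : W') : Fin 4 × Fin 4 → K) = 0 := by
      refine hdet' _ (x₁ - x₂).2 (fun j => ?_) (fun j => ?_)
      · have := congrArg (fun v : (Fin 4 → K) × (Fin 4 → K) => v.1 j) hsub; exact this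
      · have := congrArg (fun v : (Fin 4 → K) × (Fin 4 → K) => v.2 j) hsub; exact this
    exact sub_eq_zero.1 (Subtype.ext hzero)
  set V' : Submodule K ((Fin 4 → K) × (Fin 4 → K)) := LinearMap.range f with hV'
  have hV7 : finrank K V' = 7 := by rw [hV', LinearMap.finrank_range_of_inj hfinj, h7']
  -- a linear section `L : K⁴ × K⁴ → matrices`, `L y ∈ W'` and `π (L y) = y` on `V'`
  let e : W' ≃ₗ[K] V' := LinearEquiv.ofInjective f hfinj
  obtain ⟨L, hL⟩ := LinearMap.exists_extend (W'.subtype ∘ₗ e.symm.toLinearMap)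
  have hLmem : ∀ y (hy : y ∈ V'), L y ∈ W' := fun y hy => by
    have h := LinearMap.congr_fun hL ⟨y, hy⟩
    simp only [LinearMap.coe_comp, Submodule.coe_subtype, Function.comp_apply] at h
    rw [h]
    exact (e.symm ⟨y, hy⟩).2
  have hLπ : ∀ y (hy : y ∈ V'), π (L y) = y := fun y hy => by
    have h := LinearMap.congr_fun hL ⟨y, hy⟩
    simp only [LinearMap.coe_comp, Submodule.coe_subtype, Function.comp_apply] at h
    rw [h]
    have h2 : f (e.symm ⟨y, hy⟩) = y := by
      have := LinearEquiv.ofInjective_apply f (h := hfinj) (e.symm ⟨y, hy⟩)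
      rw [LinearEquiv.apply_symm_apply] at this
      exact this.symm
    exact h2
  -- (3) the bilinear forms on `(K⁴ × K⁴) × (K⁴ × K⁴)`
  let emb : ((Fin 4 → K) × (Fin 4 → K)) →ₗ[K] (Fin 4 × Fin 4 → K) :=
    { toFun := fun ab p => ![ab.1, ab.2, 0, 0] p.1 p.2
      map_add' := fun u v => by
        funext p; obtain ⟨i, j⟩ := p
        fin_cases i <;> simp
      map_smul' := fun r u => by
        funext p; obtain ⟨i, j⟩ := p
        fin_cases i <;> simp }
  have hemb : ∀ ab (i j : Fin 4), emb ab (i, j) = ![ab.1, ab.2, 0, 0] i j := fun _ _ _ => rfl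
  let t : Fin 8 → (((Fin 4 → K) × (Fin 4 → K)) →ₗ[K] ((Fin 4 → K) × (Fin 4 → K)) →ₗ[K] K) :=
    fun r => ((β' r).comp emb).compl₂ L
  have ht : ∀ r ab y, t r ab y = β' r (emb ab) (L y) := fun _ _ _ => rfl
  refine IR9H V' hV7 c' t fun a b y hy => ?_
  -- (4) the `s²`-coefficient of `per_4 (emb (a,b) + s • L y)`
  set x := L y with hx
  have hxW : x ∈ W' := hLmem y hy
  have hx2 : ∀ j, x (2, j) = y.1 j := fun j => by
    have := congrArg (fun v : (Fin 4 → K) × (Fin 4 → K) => v.1 j) (hLπ y hy); exact this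
  have hx3 : ∀ j, x (3, j) = y.2 j := fun j => by
    have := congrArg (fun v : (Fin 4 → K) × (Fin 4 → K) => v.2 j) (hLπ y hy); exact this
  obtain ⟨e₀, e₁, he⟩ := hfam' (emb (a, b)) x hxW
  have hper : ∀ s : K, eval (emb (a, b) + s • x) (perPoly (Fin 4) K) =
      s ^ 2 * ((Matrix.of ![a, b, y.1, y.2]).permanent +
        s * ((Matrix.of ![(fun j => x (0, j)), b, y.1, y.2]).permanent +
              (Matrix.of ![a, (fun j => x (1, j)), y.1, y.2]).permanent) +
        s ^ 2 * (Matrix.of ![(fun j => x (0, j)), (fun j => x (1, j)), y.1, y.2]).permanent) := by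
    intro s
    rw [eval_perPoly]
    have hM : (Matrix.of fun i j => (emb (a, b) + s • x) (i, j)) =
        Matrix.of ![a + s • (fun j => x (0, j)), b + s • (fun j => x (1, j)), s • y.1, s • y.2] := by
      ext i j
      rw [Matrix.of_apply, Pi.add_apply, Pi.smul_apply, hemb, Matrix.of_apply]
      fin_cases i <;> simp [hx2, hx3]
    rw [hM, per_smul_row₂, per_smul_row₃, per_add_row₀, permanent_rows_smul₀, per_add_row₁,
      per_add_row₁, permanent_rows_smul₁, permanent_rows_smul₁]
    ring
  have hcoef := quartic_coeffs_eq_zero e₀ e₁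
    (∑ k, c' k * (β' k (emb (a, b)) x) ^ 2 - (Matrix.of ![a, b, y.1, y.2]).permanent)
    (-((Matrix.of ![(fun j => x (0, j)), b, y.1, y.2]).permanent +
        (Matrix.of ![a, (fun j => x (1, j)), y.1, y.2]).permanent))
    (-(Matrix.of ![(fun j => x (0, j)), (fun j => x (1, j)), y.1, y.2]).permanent) fun s => by
      have h := he s
      rw [hper s] at h
      linear_combination -h
  have h2 := hcoef.2.2.1
  simp only [ht]
  linear_combination h2

/-- **Cell `(9, 7, 8)` is empty GIVEN IR9H** (inner rank `≥ 9` of the `2|2` split of `per_4` on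
every `7`-dimensional subspace of `K⁴ × K⁴`). [folklore] -/
theorem false_of_rank_nine_le_twentySeven_of_IR9H (K : Type*) [Field K] [CharZero K]
    (IR9H : ∀ V' : Submodule K ((Fin 4 → K) × (Fin 4 → K)), finrank K V' = 7 →
      ∀ (c : Fin 8 → K)
        (t : Fin 8 → (((Fin 4 → K) × (Fin 4 → K)) →ₗ[K] ((Fin 4 → K) × (Fin 4 → K)) →ₗ[K] K)),
      ¬ (∀ a b : Fin 4 → K, ∀ y ∈ V',
          ∑ r, c r * (t r (a, b) y) ^ 2 = (Matrix.of ![a, b, y.1, y.2]).permanent))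
    {m : ℕ} (hm : m ≤ 27)
    {i₀ : Fin m} {D : Matrix {i // i ≠ i₀} {i // i ≠ i₀} K}
    {bL : (Fin 4 × Fin 4 → K) →ₗ[K] ({i // i ≠ i₀} → K)}
    {CL : (Fin 4 × Fin 4 → K) →ₗ[K] Matrix {i // i ≠ i₀} {i // i ≠ i₀} K} {κ : K}
    (hD : IsUnit D.det) (hDs : Dᵀ = D) (hCs : ∀ z, (CL z)ᵀ = CL z) (hκ : κ ≠ 0)
    (hi : ∀ z, bL z ⬝ᵥ D⁻¹ *ᵥ bL z = 0)
    (hii : ∀ z, bL z ⬝ᵥ (D⁻¹ * CL z * D⁻¹) *ᵥ bL z = 0)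
    (hiii : ∀ z, D.det * (bL z ⬝ᵥ (D⁻¹ * CL z * D⁻¹ * CL z * D⁻¹) *ᵥ bL z) =
      -(κ * eval z (perPoly (Fin 4) K)))
    (hV4 : ∀ x ∈ LinearMap.ker bL, ∀ r c : Fin 4,
      ((Matrix.of fun i j => x (i, j)).submatrix r.succAbove c.succAbove).permanent = 0)
    (hcard : Fintype.card {i // i ≠ i₀} + 1 = m)
    (hrn : finrank K (LinearMap.range bL) + finrank K (LinearMap.ker bL) = 16)
    (h9 : finrank K (LinearMap.range bL) = 9) : False :=
  false_of_rank_nine_le_twentySeven_of_H978 K hm hD hDs hCs hκ hi hii hiii hV4 hcard hrn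
    (H978_of_IR9H IR9H) h9

end Summit.ValiantsHypothesis.ValiantsHypothesis.Theorems.SymPencilSdcPerFourCellNineSevenSplit

end
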